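import Summits.Ventures.PercRepro.ProfileFlatUpset
import Mathlib.Combinatorics.Hall.Finite

/-!
# PercRepro — (PM-flat): (H-gen) FOR ALL UP-SETS IS A PERFECT MATCHING `BI_k → BI_{n−k}` ALONG FLAT CONTAINMENT `cl X ⊆ cl X′`
(p10, gen 26; the equivalence is a theorem, the matching a conjecture, NOT asserted)

For a finite matroid `M` on `n` elements and `2k < n`, the EXACT-mirror containment matching `BI_k → BI_{n−k}` (`X ⊆ X′`) fails
(gen 26: `Θ₃` + chord), but the graph `X ∼ X′ iff cl X ⊆ cl X′` — whose neighbourhoods are the unions of the `β`-pools above `cl X`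
— has a saturating matching on every matroid with ≤ 8 elements (pmflat.py) and, by the equivalence below, on every matroid
with ≤ 9 elements (the max-flow form of (H-gen), kit j297474):

  (PM-flat)  for every `2k < n` there is an injection `f : BI_k → BI_{n−k}` with `cl X ⊆ cl (f X)`

(`BiIndepFlatSup`; since `P_k = P_{n−k}` it is a bijection — equivalently a PERMUTATION `ψ` of `BI_k` with `X ⊆ cl(E ∖ ψ X)`).
THEOREMS: `card_filter_clF_mem_le_mirror_of_flatSup` — (PM-flat) ⟹ (H-gen) for every up-set `U` (the closure-in-`U` form:
`#{X ∈ BI_k : cl X ∈ U} ≤ #{X ∈ BI_{n−k} : cl X ∈ U}`); `flatSup_of_forall_upset` — the converse: (H-gen) for every up-set gives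
Hall's condition for the flat-containment graph (take `U` = the up-set generated by the closures of a family `𝒜 ⊆ BI_k`), hence
the matching (Mathlib's Hall theorem); so **`biIndepFlatSup_iff_forall_upset`: (PM-flat) ⟺ (H-gen) for all up-sets of flats**,
for every finite matroid.  Nothing here asserts (PM-flat) or (H-gen).
-/

open scoped Matroid

namespace PercRepro.Cogirth

open Finset ThmH Skew

variable {α : Type} [DecidableEq α] {M : Matroid α} [M.Finite]

/-- The flat-containment neighbours of a family `𝒜 ⊆ BI_k` at level `m`: the `X′ ∈ BI_m` with `cl X ⊆ cl X′` for some
`X ∈ 𝒜`. -/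
noncomputable def flatNbrs (M : Matroid α) [M.Finite] (𝒜 : Finset (Finset α)) (m : ℕ) : Finset (Finset α) :=
  (biIndepSets M m).filter (fun X' => ∃ X ∈ 𝒜, clF M X ⊆ clF M X')

/-- **(PM-flat), injection form (NOT asserted)**: for every `2k < n`, an injection `f` on `BI_k` with
`f X ∈ BI_{n−k}` and `cl X ⊆ cl (f X)`. -/
def BiIndepFlatSup (α : Type) [DecidableEq α] : Prop :=
  ∀ (M : Matroid α) [M.Finite] (k : ℕ), 2 * k < (gr M).card →
    ∃ f : Finset α → Finset α, Set.InjOn f (biIndepSets M k) ∧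
      ∀ X ∈ biIndepSets M k, f X ∈ biIndepSets M ((gr M).card - k) ∧ clF M X ⊆ clF M (f X)

/-- **(PM-flat), Hall form (NOT asserted)**: every `𝒜 ⊆ BI_k` (`2k < n`) has at least `#𝒜` flat-containment neighbours in
`BI_{n−k}`. -/
def BiIndepFlatSupHall (α : Type) [DecidableEq α] : Prop :=
  ∀ (M : Matroid α) [M.Finite] (k : ℕ), 2 * k < (gr M).card →
    ∀ 𝒜 ⊆ biIndepSets M k, 𝒜.card ≤ (flatNbrs M 𝒜 ((gr M).card - k)).card

/-- **(H-gen) for every up-set, closure form** (the statement of ProfilePointedMirrorUpset's `SepMirror` in the `u`-form). -/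
def UpsetMirror (α : Type) [DecidableEq α] : Prop :=
  ∀ (M : Matroid α) [M.Finite] (U : Finset (Finset α)), UpFlats M U → ∀ k : ℕ, 2 * k < (gr M).card →
    ((biIndepSets M k).filter (fun X => clF M X ∈ U)).card ≤
      ((biIndepSets M ((gr M).card - k)).filter (fun X => clF M X ∈ U)).card

/-! ### (PM-flat) ⟹ (H-gen) -/

/-- An injection along flat containment sends the sets with closure in an up-set `U` to sets with closure in `U`. -/
theorem card_filter_clF_mem_le_mirror_of_flatSup (h : BiIndepFlatSup α) {U : Finset (Finset α)} (hU : UpFlats M U)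
    {k : ℕ} (hk : 2 * k < (gr M).card) :
    ((biIndepSets M k).filter (fun X => clF M X ∈ U)).card ≤
      ((biIndepSets M ((gr M).card - k)).filter (fun X => clF M X ∈ U)).card := by
  obtain ⟨f, hinj, hf⟩ := h M k hk
  apply card_le_card_of_injOn f
  · intro X hX
    rw [mem_coe, mem_filter] at hX ⊢
    obtain ⟨hXb, hXU⟩ := hX
    exact ⟨(hf X hXb).1, hU.up _ hXU _ (isFlatF_clF _) (hf X hXb).2⟩
  · exact hinj.mono (fun X hX => (mem_filter.1 hX).1)

/-- (PM-flat) ⟹ (H-gen) for every up-set. -/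
theorem upsetMirror_of_flatSup (h : BiIndepFlatSup α) : UpsetMirror α :=
  fun _ _ _ hU _ hk => card_filter_clF_mem_le_mirror_of_flatSup h hU hk

/-! ### (H-gen) for every up-set ⟹ Hall's condition for the flat-containment graph -/

open scoped Classical in
/-- The up-set of flats generated by the closures of a family `𝒜`. -/
noncomputable def genUpset (M : Matroid α) [M.Finite] (𝒜 : Finset (Finset α)) : Finset (Finset α) :=
  (gr M).powerset.filter (fun F => IsFlatF M F ∧ ∃ X ∈ 𝒜, clF M X ⊆ F)

open scoped Classical in
/-- Membership in `genUpset`. -/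
theorem mem_genUpset {𝒜 : Finset (Finset α)} {F : Finset α} :
    F ∈ genUpset M 𝒜 ↔ F ⊆ gr M ∧ IsFlatF M F ∧ ∃ X ∈ 𝒜, clF M X ⊆ F := by
  unfold genUpset
  rw [mem_filter, mem_powerset]

/-- `genUpset` is an up-set of flats. -/
theorem upFlats_genUpset (𝒜 : Finset (Finset α)) : UpFlats M (genUpset M 𝒜) where
  flat := fun F hF => (mem_genUpset.1 hF).2.1
  up := fun F hF G hG hFG => by
    rw [mem_genUpset] at hF ⊢
    obtain ⟨-, -, X, hX, hXF⟩ := hF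
    exact ⟨hG.1, hG, X, hX, hXF.trans hFG⟩

/-- The sets of `BI_m` with closure in `genUpset 𝒜` are exactly the flat-containment neighbours of `𝒜`. -/
theorem filter_clF_mem_genUpset_eq (𝒜 : Finset (Finset α)) (m : ℕ) :
    (biIndepSets M m).filter (fun X => clF M X ∈ genUpset M 𝒜) = flatNbrs M 𝒜 m := by
  unfold flatNbrs
  apply filter_congr
  intro X' _
  rw [mem_genUpset]
  constructor
  · rintro ⟨-, -, h⟩
    exact h
  · intro h
    exact ⟨clF_subset_gr_fu _, isFlatF_clF _, h⟩

/-- (H-gen) for every up-set gives Hall's condition for the flat-containment graph: `𝒜 ⊆ BI_k` lies inside the sets with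
closure in the up-set it generates. -/
theorem flatSupHall_of_upsetMirror (h : UpsetMirror α) : BiIndepFlatSupHall α := by
  intro M _ k hk 𝒜 h𝒜
  have h1 := h M (genUpset M 𝒜) (upFlats_genUpset 𝒜) k hk
  rw [filter_clF_mem_genUpset_eq, filter_clF_mem_genUpset_eq] at h1
  refine le_trans ?_ h1
  apply card_le_card
  intro X hX
  unfold flatNbrs
  rw [mem_filter]
  exact ⟨h𝒜 hX, X, hX, Subset.refl _⟩

/-! ### Hall's condition ⟹ the matching (Mathlib's Hall theorem) -/

/-- The Hall form of (PM-flat) gives the injection form. -/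
theorem flatSup_of_flatSupHall (h : BiIndepFlatSupHall α) : BiIndepFlatSup α := by
  intro M _ k hk
  have hH := h M k hk
  let T : Finset (Finset α) := biIndepSets M ((gr M).card - k)
  let t : {X // X ∈ biIndepSets M k} → Finset (Finset α) := fun X => T.filter (fun X' => clF M X.1 ⊆ clF M X')
  have hall : ∀ s : Finset {X // X ∈ biIndepSets M k}, s.card ≤ (s.biUnion t).card := by
    intro s
    have h1 := hH (s.map (Function.Embedding.subtype _)) (by
      intro X hX
      rw [mem_map] at hX
      obtain ⟨Y, _, rfl⟩ := hX
      exact Y.2)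
    rw [card_map] at h1
    refine h1.trans (card_le_card ?_)
    intro X' hX'
    unfold flatNbrs at hX'
    rw [mem_filter] at hX'
    obtain ⟨hX'T, Y, hY, hYX'⟩ := hX'
    rw [mem_map] at hY
    obtain ⟨Z, hZ, rfl⟩ := hY
    rw [mem_biUnion]
    refine ⟨Z, hZ, ?_⟩
    simp only [t, mem_filter]
    exact ⟨hX'T, hYX'⟩
  obtain ⟨f, hfinj, hft⟩ := (all_card_le_biUnion_card_iff_existsInjective' t).1 hall
  refine ⟨fun X => if hX : X ∈ biIndepSets M k then f ⟨X, hX⟩ else X, ?_, ?_⟩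
  · intro X hX Y hY hXY
    have hX' : X ∈ biIndepSets M k := hX
    have hY' : Y ∈ biIndepSets M k := hY
    dsimp only at hXY
    rw [dif_pos hX', dif_pos hY'] at hXY
    exact congrArg Subtype.val (hfinj hXY)
  · intro X hX
    dsimp only
    rw [dif_pos hX]
    have h1 := hft ⟨X, hX⟩
    simp only [t, mem_filter] at h1
    exact h1

/-- The injection form of (PM-flat) gives the Hall form. -/
theorem flatSupHall_of_flatSup (h : BiIndepFlatSup α) : BiIndepFlatSupHall α := by
  intro M _ k hk 𝒜 h𝒜
  obtain ⟨f, hinj, hf⟩ := h M k hk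
  apply card_le_card_of_injOn f
  · intro X hX
    have hX' : X ∈ 𝒜 := hX
    have hXk : X ∈ biIndepSets M k := h𝒜 hX'
    unfold flatNbrs
    rw [mem_coe, mem_filter]
    exact ⟨(hf X hXk).1, X, hX', (hf X hXk).2⟩
  · exact hinj.mono (fun X hX => h𝒜 hX)

/-- **(PM-flat) ⟺ (H-gen) FOR ALL UP-SETS OF FLATS** (for every finite matroid on `α`). -/
theorem biIndepFlatSup_iff_forall_upset : BiIndepFlatSup α ↔ UpsetMirror α :=
  ⟨upsetMirror_of_flatSup, fun h => flatSup_of_flatSupHall (flatSupHall_of_upsetMirror h)⟩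

/-- (PM-flat) in its two forms is one statement. -/
theorem biIndepFlatSup_iff_flatSupHall : BiIndepFlatSup α ↔ BiIndepFlatSupHall α :=
  ⟨flatSupHall_of_flatSup, flatSup_of_flatSupHall⟩

end PercRepro.Cogirth
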